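import Mathlib
import Summits.ResolutionOfSingularities.ResolutionOfSingularities.Theorems.RisoStrataRisoCentresResolvePlumbing
import Literature.AlgebraicGeometry.Resolution.RegularLocusPerfectField

/-!
# Route RisoStrata — crux `RisoCentresResolve` (stmt-ResolutionOfSingularities-18546), line `Sketch`:
# non-vacuity of the riso tower (admissible denominators always exist)

For a finitely generated `k`-subalgebra `B ⊆ O` of a field `K` (`k` algebraically closed, `O` a
valuation ring of `K`) and ANY cut predicate `P`, the centre ideal `risoCen P B d` (an intersection
of SINGULAR maximal ideals) contains a nonzero element — the generic point of the domain `B` is a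
regular point and the regular locus is open (`k` perfect), so some `f ≠ 0` lies in every singular
prime — and therefore an admissible denominator exists: a generator of `risoCen P B d` of minimal
value (`rcr_exists_risoValid`). Consequently admissible chart paths of every length exist along every
valuation ring (`rcr_exists_admissible`): the hypothesis of the crux is never vacuous (as the
refuter passes observed informally), and the crux implies its local-uniformization form.
-/

noncomputable section

set_option linter.dupNamespace false -- mandated namespace of this single-conjunct summit

namespace Summit.ResolutionOfSingularities.ResolutionOfSingularities.Theorems

open Literature.AlgebraicGeometry.Resolution

/-- **The centre ideal is never zero**: some `f ≠ 0` of the finitely generated `B` lies in every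
singular maximal ideal, hence in `risoCen P B d` (generic regularity + openness of the regular
locus over the perfect field `k`). [folklore] -/
theorem rcr_exists_ne_zero_mem_risoCen {k K : Type} [Field k] [IsAlgClosed k] [Field K] [Algebra k K]
    (P : ∀ B : Subalgebra k K, Ideal ↥B → ℕ → Prop) (B : Subalgebra k K) (hB : B.FG) (d : ℕ) :
    ∃ f : ↥B, f ≠ 0 ∧ f ∈ risoCen P B d := by
  classical
  haveI : Algebra.FiniteType k ↥B := (Subalgebra.fg_iff_finiteType B).mp hB
  have hopen : IsOpen (regularLocus ↥B) := isOpen_regularLocus_of_perfectField k ↥B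
  -- the generic point is regular: `B_{(0)} = Frac B` is a field
  let η : PrimeSpectrum ↥B := ⟨⊥, Ideal.isPrime_bot⟩
  have hη : η ∈ regularLocus ↥B := by
    change IsRegularLocalRing (Localization.AtPrime (⊥ : Ideal ↥B))
    haveI : IsLocalization (nonZeroDivisors ↥B) (Localization.AtPrime (⊥ : Ideal ↥B)) := by
      rw [← Ideal.primeCompl_bot]
      infer_instance
    have hF := (IsFractionRing.toField ↥B (K := Localization.AtPrime (⊥ : Ideal ↥B))).toIsField
    letI := hF.toField
    infer_instance
  -- a basic open neighbourhood `D(f) ⊆ Reg B` of the generic point, `f ≠ 0`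
  obtain ⟨_, ⟨f, rfl⟩, hηf, hfU⟩ :=
    PrimeSpectrum.isTopologicalBasis_basic_opens.exists_subset_of_mem_open hη hopen
  have hf0 : f ≠ 0 := by
    intro h0
    rw [h0] at hηf
    exact (PrimeSpectrum.mem_basicOpen _ _).mp hηf (Submodule.zero_mem _)
  refine ⟨f, hf0, ?_⟩
  -- `f` lies in every singular prime, in particular in every index of `risoCen`
  unfold risoCen
  simp only [Submodule.mem_iInf]
  rintro m ⟨hm, hsing, -⟩
  by_contra hfm
  apply hsing
  have hmem : (⟨m, hm.isPrime⟩ : PrimeSpectrum ↥B) ∈ regularLocus ↥B :=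
    hfU ((PrimeSpectrum.mem_basicOpen _ _).mpr hfm)
  exact hmem

/-- **Admissible denominators exist**: for `B ⊆ O` finitely generated there is `xt` with
`risoValid P O B d xt` — a generator of the (finitely generated, nonzero) centre ideal of minimal
value. [folklore] -/
theorem rcr_exists_risoValid {k K : Type} [Field k] [IsAlgClosed k] [Field K] [Algebra k K]
    (P : ∀ B : Subalgebra k K, Ideal ↥B → ℕ → Prop) (O : ValuationSubring K) (B : Subalgebra k K)
    (hB : B.FG) (hBO : B.toSubring ≤ O.toSubring) (d : ℕ) : ∃ xt : K, risoValid P O B d xt := by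
  classical
  haveI := isNoetherianRing_of_fg hB
  obtain ⟨c, hc⟩ := (IsNoetherian.noetherian (risoCen P B d) : (risoCen P B d).FG)
  obtain ⟨f, hf0, hf⟩ := rcr_exists_ne_zero_mem_risoCen P B hB d
  have hne : ∃ x ∈ c, ((x : ↥B) : K) ≠ 0 := by
    by_contra! hcon
    apply hf0
    have hbot : risoCen P B d = ⊥ := by
      rw [← hc, Ideal.span_eq_bot]
      intro x hx
      exact Subtype.ext (hcon x hx)
    rw [hbot] at hf
    exact (Submodule.mem_bot _).mp hf
  obtain ⟨u₀, hu₀, hu0, hmax⟩ := exists_max_valuation O c (fun x : ↥B => (x : K)) hne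
  have hu₀Cen : (u₀ : ↥B) ∈ risoCen P B d := hc ▸ Ideal.subset_span hu₀
  refine ⟨(u₀ : K), hu0, ⟨u₀, hu₀Cen, rfl⟩, fun a' ha' => ?_⟩
  -- `a' = ∑ bᵢ cᵢ`, and `cᵢ / u₀ ∈ O`
  have ha'' : a' ∈ Submodule.span ↥B (c : Set ↥B) := by rw [hc]; exact ha'
  rw [Submodule.mem_span_finset] at ha''
  obtain ⟨g, -, hg⟩ := ha''
  rw [← hg, AddSubmonoidClass.coe_finsetSum, Finset.sum_mul]
  refine O.toSubring.sum_mem fun i hi => ?_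
  rw [smul_eq_mul, MulMemClass.coe_mul, mul_assoc]
  refine O.toSubring.mul_mem (hBO (g i).2) ?_
  have hv0 : O.valuation ((u₀ : ↥B) : K) ≠ 0 := by simpa using hu0
  change ((i : ↥B) : K) * ((u₀ : ↥B) : K)⁻¹ ∈ O
  rw [← O.valuation_le_one_iff, map_mul, map_inv₀]
  calc O.valuation ((i : ↥B) : K) * (O.valuation ((u₀ : ↥B) : K))⁻¹
      ≤ O.valuation ((u₀ : ↥B) : K) * (O.valuation ((u₀ : ↥B) : K))⁻¹ := by
        gcongr
        exact hmax i hi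
    _ = 1 := mul_inv_cancel₀ hv0

/-- Two towers whose denominators agree below stage `t` have the same stages up to `t`. [folklore] -/
theorem risoStage_congr {k K : Type} [Field k] [Field K] [Algebra k K]
    (P : ∀ B : Subalgebra k K, Ideal ↥B → ℕ → Prop) (B₀ : Subalgebra k K)
    (sched : List ℕ) {x x' : ℕ → K} {t : ℕ} (h : ∀ s, s < t → x s = x' s) :
    risoStage P B₀ sched x t = risoStage P B₀ sched x' t := by
  induction t with
  | zero => rw [risoStage_zero, risoStage_zero]
  | succ t ih =>
    have ih' := ih (fun s hs => h s (Nat.lt_succ_of_lt hs))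
    by_cases ht : t < sched.length
    · rw [risoStage_succ P B₀ sched x ht, risoStage_succ P B₀ sched x' ht, ih', h t (Nat.lt_succ_self t)]
    · rw [not_lt] at ht
      rw [risoStage_eq_of_length_le P B₀ sched x (ht.trans (Nat.le_succ t)),
        risoStage_eq_of_length_le P B₀ sched x' (ht.trans (Nat.le_succ t)),
        ← risoStage_eq_of_length_le P B₀ sched x ht, ← risoStage_eq_of_length_le P B₀ sched x' ht, ih']

/-- **Admissible chart paths of every length exist** along every valuation ring `O ⊇ B₀`
(`B₀` finitely generated): denominators `x` with `risoValid` at every stage `< t`. [folklore] -/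
theorem rcr_exists_admissible {k K : Type} [Field k] [IsAlgClosed k] [Field K] [Algebra k K]
    (P : ∀ B : Subalgebra k K, Ideal ↥B → ℕ → Prop) (O : ValuationSubring K) (B₀ : Subalgebra k K)
    (hB₀ : B₀.FG) (hB₀O : B₀.toSubring ≤ O.toSubring) (sched : List ℕ) (t : ℕ) :
    ∃ x : ℕ → K, ∀ s, s < t → s < sched.length →
      risoValid P O (risoStage P B₀ sched x s) (sched.getD s 0) (x s) := by
  induction t with
  | zero => exact ⟨fun _ => 0, fun s hs => absurd hs (Nat.not_lt_zero s)⟩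
  | succ t ih =>
    obtain ⟨x, hx⟩ := ih
    -- stage `t` along `x` is finitely generated and lies in `O`
    have hfg : (risoStage P B₀ sched x t).FG := risoStage_fg hB₀ t
    have hle : (risoStage P B₀ sched x t).toSubring ≤ O.toSubring :=
      risoStage_toSubring_le hB₀O (fun s hs hs' => hx s hs hs')
    obtain ⟨xt, hxt⟩ := rcr_exists_risoValid P O _ hfg hle (sched.getD t 0)
    refine ⟨Function.update x t xt, fun s hs hs' => ?_⟩
    have hagree : ∀ s', s' < t → x s' = Function.update x t xt s' := fun s' hs' => by
      rw [Function.update_of_ne (Nat.ne_of_lt hs')]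
    rcases Nat.lt_succ_iff_lt_or_eq.mp hs with hlt | rfl
    · rw [← risoStage_congr P B₀ sched (fun s' hs'' => hagree s' (hs''.trans hlt)),
        Function.update_of_ne (Nat.ne_of_lt hlt)]
      exact hx s hlt hs'
    · rw [← risoStage_congr P B₀ sched hagree, Function.update_self]
      exact hxt

end Summit.ResolutionOfSingularities.ResolutionOfSingularities.Theorems

end
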